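import Literature.Geometry.Kaehler.AlternatingFormInnerFrameBounds
import Literature.Analysis.InnerProduct.GramSchmidtPerturbation
import HarnessLib

/-!
# Transporting the inner product of `k`-covectors along an almost isometric isomorphism

Layer `Literature/Geometry/Kaehler`, companion of `AlternatingFormInnerFrameBounds`. Setting: two
`n`-dimensional oriented real inner product spaces `(V₀, o₀)`, `(V₁, o₁)` and a continuous linear
isomorphism `T : V₀ ≃L[ℝ] V₁` with `o₁ = T_* o₀` which is **`δ`-almost isometric**:
`|⟪T bᵢ, T bⱼ⟫ - δᵢⱼ| ≤ δ` on a positively oriented orthonormal basis `b` of `V₀` (think: the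
differential `dΦₓ` of a diffeomorphism between two Riemannian manifolds whose pulled-back metric is
close to the metric of the source). For `k`-covectors `α`, `β` on `V₀` let `T_*α = α ∘ ΛT⁻¹` be
the transported covectors on `V₁`. The pull-back of the top form `⟪T_*α, T_*β⟫₁ vol_{o₁}` along `T`
is `(⟪T_*α, T_*β⟫₁ · vol_{o₁}(T b)) vol_{o₀}` (`volumeFormL_compContinuousLinearMap_eq_smul`), and
this file proves that its coefficient is close to `⟪α, β⟫₀`:

* `norm_symm_le_two_of_gram` — `‖T⁻¹‖ ≤ 2` if `n δ ≤ 3/4`;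
* `abs_inner_transport_mul_volumeForm_sub_le` — **for every `ε > 0` there is `δ₀ > 0`, depending
  only on `n`, `k`, `ε`, such that `δ ≤ δ₀` implies
  `|⟪T_*α, T_*β⟫₁ · vol_{o₁}(T ∘ b) - ⟪α, β⟫₀| ≤ ε (⟪α, α⟫₀ + ⟪β, β⟫₀)` for all `α, β`**
  (Gram–Schmidt on the almost orthonormal frame `T b` of `V₁`,
  `Literature.Analysis.InnerProduct.gramSchmidtNormed_sub_le`; Warner's formula for `⟪·,·⟫₁` in that
  orthonormal basis pulls back to a frame sum on `V₀` over the frame `T⁻¹(GS(T b))`, `‖T⁻¹‖ δ`-close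
  to `b`; the volume factor is `vol_{o₁}(T b) = 1 / vol_{o₀}(T⁻¹ GS(T b))`; then
  `abs_frameSum_mul_volumeForm_sub_alternatingFormInner_le`).

This is the pointwise input of the comparison of the `L²` products of forms on two nearby fibres of a
family (Voisin I, Prop. 9.20, in `AlgebraicGeometry/Motives/FiberNetExistenceProofs`).
No definitions, no named facts (D-0026). [folklore]
-/

noncomputable section

namespace Literature.Geometry.Kaehler

open Module ContinuousAlternatingMap Finset InnerProductSpace
open scoped Nat InnerProductSpace RealInnerProductSpace

open Literature.Analysis.InnerProduct

universe u v

variable {V₀ : Type u} [NormedAddCommGroup V₀] [InnerProductSpace ℝ V₀] [FiniteDimensional ℝ V₀]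
  {V₁ : Type v} [NormedAddCommGroup V₁] [InnerProductSpace ℝ V₁] [FiniteDimensional ℝ V₁]
  {n : ℕ} [Fact (finrank ℝ V₀ = n)] [Fact (finrank ℝ V₁ = n)] {k : ℕ}

/-! ### Almost isometries -/

omit [FiniteDimensional ℝ V₀] [FiniteDimensional ℝ V₁] [Fact (finrank ℝ V₀ = n)]
  [Fact (finrank ℝ V₁ = n)] in
/-- **An almost isometry on an orthonormal basis is almost isometric everywhere**:
`|‖T v‖² - ‖v‖²| ≤ n δ ‖v‖²` if `|⟪T bᵢ, T bⱼ⟫ - δᵢⱼ| ≤ δ`. [folklore] -/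
theorem abs_norm_sq_map_sub_le_of_gram (T : V₀ →L[ℝ] V₁) (b : OrthonormalBasis (Fin n) ℝ V₀) {δ : ℝ}
    (hδ0 : 0 ≤ δ) (hT : ∀ i j, |⟪T (b i), T (b j)⟫ - (if i = j then 1 else 0)| ≤ δ) (v : V₀) :
    |‖T v‖ ^ 2 - ‖v‖ ^ 2| ≤ n * δ * ‖v‖ ^ 2 := by
  classical
  set c : Fin n → ℝ := fun i ↦ ⟪b i, v⟫ with hc
  have hv : v = ∑ i, c i • b i := (b.sum_repr' v).symm
  have hTv : T v = ∑ i, c i • T (b i) := by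
    conv_lhs => rw [hv]
    simp [_root_.map_sum, map_smul]
  have hnormv : ‖v‖ ^ 2 = ∑ i, c i ^ 2 := by
    rw [← real_inner_self_eq_norm_sq]
    conv_lhs => rw [hv]
    simp only [sum_inner, inner_sum, inner_smul_left, inner_smul_right, RCLike.conj_to_real]
    refine sum_congr rfl fun i _ ↦ ?_
    rw [sum_eq_single i]
    · simp [pow_two]
    · intro j _ hji
      simp [orthonormal_iff_ite.1 b.orthonormal, hji]
    · simp
  have hnormTv : ‖T v‖ ^ 2 = ∑ i, ∑ j, c i * c j * ⟪T (b i), T (b j)⟫ := by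
    rw [← real_inner_self_eq_norm_sq, hTv, sum_inner]
    refine sum_congr rfl fun i _ ↦ ?_
    rw [inner_sum]
    refine sum_congr rfl fun j _ ↦ ?_
    rw [real_inner_smul_left, real_inner_smul_right]
    ring
  have hnormv' : ‖v‖ ^ 2 = ∑ i, ∑ j, c i * c j * (if i = j then 1 else 0) := by
    rw [hnormv]
    refine sum_congr rfl fun i _ ↦ ?_
    rw [sum_eq_single i]
    · simp [pow_two]
    · intro j _ hji; simp [Ne.symm hji]
    · simp
  rw [hnormTv, hnormv', ← sum_sub_distrib]
  simp_rw [← sum_sub_distrib, ← mul_sub]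
  calc |∑ i, ∑ j, c i * c j * (⟪T (b i), T (b j)⟫ - if i = j then 1 else 0)|
      ≤ ∑ i, |∑ j, c i * c j * (⟪T (b i), T (b j)⟫ - if i = j then 1 else 0)| := abs_sum_le_sum_abs _ _
    _ ≤ ∑ i, ∑ j, |c i| * |c j| * δ := by
        refine sum_le_sum fun i _ ↦ (abs_sum_le_sum_abs _ _).trans (sum_le_sum fun j _ ↦ ?_)
        rw [abs_mul, abs_mul]
        exact mul_le_mul_of_nonneg_left (hT i j) (by positivity)
    _ = (∑ i, |c i|) ^ 2 * δ := by rw [pow_two, sum_mul_sum, sum_mul]; simp_rw [sum_mul]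
    _ ≤ (n * ∑ i, c i ^ 2) * δ := by
        refine mul_le_mul_of_nonneg_right ?_ hδ0
        have h := sq_sum_le_card_mul_sum_sq (s := (univ : Finset (Fin n))) (f := fun i ↦ |c i|)
        simp only [card_univ, Fintype.card_fin, sq_abs] at h
        exact h
    _ = n * δ * ∑ i, ∑ j, c i * c j * (if i = j then 1 else 0) := by rw [← hnormv', hnormv]; ring

omit [FiniteDimensional ℝ V₀] [FiniteDimensional ℝ V₁] [Fact (finrank ℝ V₀ = n)]
  [Fact (finrank ℝ V₁ = n)] in
/-- **`‖T⁻¹‖ ≤ 2`** for an almost isometry with `n δ ≤ 3/4` (`‖T v‖² ≥ (1 - nδ) ‖v‖² ≥ ‖v‖²/4`).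
[folklore] -/
theorem norm_symm_le_two_of_gram (T : V₀ ≃L[ℝ] V₁) (b : OrthonormalBasis (Fin n) ℝ V₀) {δ : ℝ}
    (hδ0 : 0 ≤ δ) (hnδ : n * δ ≤ 3 / 4)
    (hT : ∀ i j, |⟪T (b i), T (b j)⟫ - (if i = j then 1 else 0)| ≤ δ) :
    ‖(T.symm : V₁ →L[ℝ] V₀)‖ ≤ 2 := by
  refine ContinuousLinearMap.opNorm_le_bound _ zero_le_two fun w ↦ ?_
  set v := T.symm w with hv
  have hw : w = T v := by rw [hv, ContinuousLinearEquiv.apply_symm_apply]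
  have h := abs_norm_sq_map_sub_le_of_gram (T : V₀ →L[ℝ] V₁) b hδ0 hT v
  rw [ContinuousLinearEquiv.coe_coe, ← hw] at h
  have h' := (abs_le.1 h).1
  -- `‖w‖² ≥ (1 - nδ) ‖v‖² ≥ ‖v‖²/4`
  have h4 : ‖v‖ ^ 2 ≤ 4 * ‖w‖ ^ 2 := by nlinarith [sq_nonneg ‖v‖, mul_nonneg (n.cast_nonneg) hδ0]
  have : ‖v‖ ≤ 2 * ‖w‖ := by
    have h0 : 0 ≤ 2 * ‖w‖ := by positivity
    nlinarith [norm_nonneg v, norm_nonneg w]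
  simpa using this

/-! ### The volume factor -/

omit [FiniteDimensional ℝ V₀] [FiniteDimensional ℝ V₁] in
/-- **The pull-back of the volume form along `T` is `vol_{o₁}(T b) • vol_{o₀}`** for any positively
oriented orthonormal basis `b` of `V₀` (an `n`-form on `V₀` is determined by its value on `b`,
`AlternatingMap.eq_smul_basis_det`, and `vol_{o₀} = det_b`, `Orientation.volumeForm_robust`).
[folklore] -/
theorem volumeFormL_compContinuousLinearMap_eq_smul (o₀ : Orientation ℝ V₀ (Fin n))
    (o₁ : Orientation ℝ V₁ (Fin n)) (T : V₀ →L[ℝ] V₁) (b : OrthonormalBasis (Fin n) ℝ V₀)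
    (hb : b.toBasis.orientation = o₀) :
    o₁.volumeFormL.compContinuousLinearMap T = o₁.volumeForm (T ∘ b) • o₀.volumeFormL := by
  apply ContinuousAlternatingMap.toAlternatingMap_injective
  ext w
  have h := AlternatingMap.eq_smul_basis_det b.toBasis
    (o₁.volumeFormL.compContinuousLinearMap T).toAlternatingMap
  rw [h]
  simp only [AlternatingMap.smul_apply, coe_toAlternatingMap, compContinuousLinearMap_apply,
    Orientation.volumeFormL_apply, OrthonormalBasis.coe_toBasis, ContinuousAlternatingMap.coe_smul,
    Pi.smul_apply, o₀.volumeForm_robust b hb]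

omit [FiniteDimensional ℝ V₀] [FiniteDimensional ℝ V₁] in
/-- **The volume factor and the pulled-back frame**: if `c` is a positively oriented orthonormal basis
of `(V₁, T_* o₀)` then `vol_{o₁}(T b) · vol_{o₀}(T⁻¹ c) = 1` (both are determinants of bases:
`det_c(T b) = det_{T⁻¹c}(b)` and `det_{T⁻¹ c}(b) det_b(T⁻¹ c) = 1`). [folklore] -/
theorem volumeForm_map_mul_volumeForm_symm (o₀ : Orientation ℝ V₀ (Fin n)) (T : V₀ ≃L[ℝ] V₁)
    (b : OrthonormalBasis (Fin n) ℝ V₀) (hb : b.toBasis.orientation = o₀)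
    (c : OrthonormalBasis (Fin n) ℝ V₁)
    (hc : c.toBasis.orientation = Orientation.map (Fin n) T.toLinearEquiv o₀) :
    (Orientation.map (Fin n) T.toLinearEquiv o₀).volumeForm (T ∘ b) *
      o₀.volumeForm (T.symm ∘ c) = 1 := by
  rw [Orientation.volumeForm_robust _ c hc, o₀.volumeForm_robust b hb]
  -- the basis `T⁻¹ c` of `V₀`
  set b' : Basis (Fin n) ℝ V₀ := c.toBasis.map T.symm.toLinearEquiv with hb'
  have hb'coe : (⇑b' : Fin n → V₀) = T.symm ∘ c := by
    funext i; simp [hb']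
  have h1 : c.toBasis.det (T ∘ b) = b'.det b := by
    rw [hb', Basis.det_map]
    congr 1
  have h2 : b'.det = b'.det b • b.toBasis.det := by
    have := AlternatingMap.eq_smul_basis_det b.toBasis b'.det
    simpa using this
  have h3 : b'.det b' = b'.det b * b.toBasis.det b' := by
    conv_lhs => rw [h2]
    simp
  rw [h1, ← hb'coe, ← h3, Basis.det_self]

/-! ### The transported inner product -/

omit [FiniteDimensional ℝ V₁] [Fact (finrank ℝ V₁ = n)] in
/-- Cauchy–Schwarz in the crude form used below: `|⟪α, β⟫| ≤ (⟪α, α⟫ + ⟪β, β⟫)/2`. [folklore] -/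
theorem abs_alternatingFormInner_le_add_div_two (α β : V₀ [⋀^Fin k]→L[ℝ] ℝ) :
    |alternatingFormInner V₀ n k α β| ≤
      (alternatingFormInner V₀ n k α α + alternatingFormInner V₀ n k β β) / 2 := by
  set b := stdOrthonormalBasisFin V₀ n
  rw [alternatingFormInner_eq_inv_factorial_mul_sum b α β, alternatingFormInner_eq_inv_factorial_mul_sum b α α,
    alternatingFormInner_eq_inv_factorial_mul_sum b β β, abs_mul, abs_of_pos (by positivity),
    ← mul_add, mul_div_assoc]
  refine mul_le_mul_of_nonneg_left ?_ (by positivity)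
  rw [le_div_iff₀ two_pos, ← sum_add_distrib]
  calc |∑ i : Fin k → Fin n, α (b ∘ i) * β (b ∘ i)| * 2 ≤ (∑ i : Fin k → Fin n, |α (b ∘ i) * β (b ∘ i)|) * 2 :=
        mul_le_mul_of_nonneg_right (abs_sum_le_sum_abs _ _) zero_le_two
    _ = ∑ i : Fin k → Fin n, 2 * |α (b ∘ i) * β (b ∘ i)| := by rw [sum_mul]; simp_rw [mul_comm]
    _ ≤ ∑ i : Fin k → Fin n, (α (b ∘ i) * α (b ∘ i) + β (b ∘ i) * β (b ∘ i)) :=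
        sum_le_sum fun i _ ↦ by
          rw [abs_mul]
          nlinarith [sq_nonneg (|α (b ∘ i)| - |β (b ∘ i)|), sq_abs (α (b ∘ i)), sq_abs (β (b ∘ i))]

/-- **Transport of the inner product of `k`-covectors along an almost isometry.** For every
`ε > 0` there is `δ₀ > 0` depending only on `n`, `k`, `ε` with the following property. Let
`T : V₀ ≃L[ℝ] V₁` be a linear isomorphism of `n`-dimensional oriented inner product spaces with
`o₁ = T_* o₀`, `b` a positively oriented orthonormal basis of `V₀` on which `T` is `δ`-almost
isometric, `|⟪T bᵢ, T bⱼ⟫ - δᵢⱼ| ≤ δ ≤ δ₀`. Then for all `k`-covectors `α`, `β` on `V₀`, with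
`T_*α = α ∘ ΛT⁻¹`:
`|⟪T_*α, T_*β⟫₁ · vol_{o₁}(T ∘ b) - ⟪α, β⟫₀| ≤ ε (⟪α, α⟫₀ + ⟪β, β⟫₀)`.
Proof: the Gram–Schmidt orthonormalisation `c` of the frame `T b` of `V₁` is `Kδ`-close to it
(`gramSchmidtNormed_sub_le`) and positively oriented; Warner's formula in the basis `c` turns
`⟪T_*α, T_*β⟫₁` into the frame sum of `α`, `β` over `T⁻¹ c`, which is `2Kδ`-close to `b`
(`‖T⁻¹‖ ≤ 2`); `vol_{o₁}(T b) = 1/vol_{o₀}(T⁻¹ c)`; conclude with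
`abs_frameSum_mul_volumeForm_sub_alternatingFormInner_le`. [folklore] -/
theorem abs_inner_transport_mul_volumeForm_sub_le (n k : ℕ) {ε : ℝ} (hε : 0 < ε) :
    ∃ δ₀ : ℝ, 0 < δ₀ ∧ ∀ {V₀ : Type u} [NormedAddCommGroup V₀] [InnerProductSpace ℝ V₀]
      [FiniteDimensional ℝ V₀] {V₁ : Type v} [NormedAddCommGroup V₁] [InnerProductSpace ℝ V₁]
      [FiniteDimensional ℝ V₁] [Fact (finrank ℝ V₀ = n)] [Fact (finrank ℝ V₁ = n)]
      (o₀ : Orientation ℝ V₀ (Fin n)) (T : V₀ ≃L[ℝ] V₁) (b : OrthonormalBasis (Fin n) ℝ V₀)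
      (_hb : b.toBasis.orientation = o₀) {δ : ℝ} (_hδ0 : 0 ≤ δ) (_hδ : δ ≤ δ₀)
      (_hT : ∀ i j, |⟪T (b i), T (b j)⟫ - (if i = j then 1 else 0)| ≤ δ)
      (α β : V₀ [⋀^Fin k]→L[ℝ] ℝ),
      |alternatingFormInner V₁ n k (α.compContinuousLinearMap (T.symm : V₁ →L[ℝ] V₀))
          (β.compContinuousLinearMap (T.symm : V₁ →L[ℝ] V₀)) *
            (Orientation.map (Fin n) T.toLinearEquiv o₀).volumeForm (T ∘ b) -
        alternatingFormInner V₀ n k α β| ≤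
        ε * (alternatingFormInner V₀ n k α α + alternatingFormInner V₀ n k β β) := by
  -- constants depending on `n`, `k` only
  set K : ℝ := 3 * (8 * (n + 1)) ^ n with hK
  set C : ℝ := (n : ℝ) ^ (2 * k) * 4 ^ (n + k) * (n + k) with hC
  have hK0 : 0 < K := by positivity
  have hC0 : 0 ≤ C := by positivity
  -- the final bound will be `(4 C (2K) + 2 n 2ⁿ (2K) (... )) δ`; we choose `δ₀` so small that all
  -- smallness conditions hold and the bound is `≤ ε`
  set L : ℝ := 8 * C * K + 8 * n * 2 ^ n * K + 1 with hL
  have hL0 : 0 < L := by positivity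
  refine ⟨min (min (1 / (4 * (8 * ((n : ℝ) + 1)) ^ n + 4 * n + 1)) (1 / (8 * K * (n * 2 ^ n + 1) + 1)))
    (ε / L), ?_, ?_⟩
  · positivity
  intro V₀ _ _ _ V₁ _ _ _ _ _ o₀ T b hb δ hδ0 hδ hT α β
  -- unpack the smallness of `δ`
  have hδa : δ ≤ 1 / (4 * (8 * ((n : ℝ) + 1)) ^ n + 4 * n + 1) := (hδ.trans (min_le_left _ _)).trans (min_le_left _ _)
  have hδb : δ ≤ 1 / (8 * K * (n * 2 ^ n + 1) + 1) := (hδ.trans (min_le_left _ _)).trans (min_le_right _ _)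
  have hδc : δ ≤ ε / L := hδ.trans (min_le_right _ _)
  have hpow0 : 0 < (8 * ((n : ℝ) + 1)) ^ n := by positivity
  have hn0 : (0 : ℝ) ≤ n := n.cast_nonneg
  have hδ1 : δ * (4 * (8 * ((n : ℝ) + 1)) ^ n + 4 * n + 1) ≤ 1 := by
    rw [le_div_iff₀ (by positivity)] at hδa; exact hδa
  have hδGS : δ * (8 * ((n : ℝ) + 1)) ^ n ≤ 1 / 4 := by
    linarith [mul_nonneg hδ0 hn0, mul_nonneg hδ0 hpow0.le]
  have hnδ : n * δ ≤ 3 / 4 := by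
    linarith [mul_nonneg hδ0 hn0, mul_nonneg hδ0 hpow0.le]
  -- Gram–Schmidt on the frame `T b`
  set F : Fin n → V₁ := fun i ↦ T (b i) with hF
  have hgs : ∀ i, ‖gramSchmidtNormed ℝ F i - F i‖ ≤ K * δ := fun i ↦ by
    rw [hK]; exact gramSchmidtNormed_sub_le hδ0 hδGS hT i
  have hon : Orthonormal ℝ (gramSchmidtNormed ℝ F) := orthonormal_gramSchmidtNormed_of_gram hδ0 hδGS hT
  have hne : ∀ i, gramSchmidtNormed ℝ F i ≠ 0 := fun i h0 ↦ by
    have := hon.norm_eq_one i; rw [h0, norm_zero] at this; exact zero_ne_one this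
  have hcard : finrank ℝ V₁ = Fintype.card (Fin n) := by rw [Fintype.card_fin]; exact Fact.out
  set c : OrthonormalBasis (Fin n) ℝ V₁ := gramSchmidtOrthonormalBasis hcard F with hc_def
  have hc : ∀ i, c i = gramSchmidtNormed ℝ F i := fun i ↦ gramSchmidtOrthonormalBasis_apply hcard (hne i)
  -- `c` is positively oriented for `T_* o₀`
  have hδ2 : δ * (8 * K * (n * 2 ^ n + 1) + 1) ≤ 1 := by
    rw [le_div_iff₀ (by positivity)] at hδb; exact hδb
  have hδKn : 0 ≤ δ * K * (n * 2 ^ n) := by positivity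
  have hδK : 0 ≤ δ * K := by positivity
  have hKδ : K * δ ≤ 1 / 8 := by linarith
  have hcpos : ∀ i, 0 < ⟪c i, F i⟫ := fun i ↦ by
    rw [hc i]
    have := inner_gramSchmidtNormed_self_ge hδ0 hδGS hT i
    rw [← hK] at this
    linarith
  have hco : c.toBasis.orientation = Orientation.map (Fin n) T.toLinearEquiv o₀ := by
    -- orientation of `c` = orientation of the basis `T b` = `T_*` (orientation of `b`)
    have hTb : (b.toBasis.map T.toLinearEquiv).orientation = Orientation.map (Fin n) T.toLinearEquiv o₀ := by
      rw [Basis.orientation_map, hb]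
    rw [← hTb, Basis.orientation_eq_iff_det_pos]
    have hdet : c.toBasis.det (b.toBasis.map T.toLinearEquiv) = ∏ i, ⟪c i, F i⟫ := by
      have h := gramSchmidtOrthonormalBasis_det hcard F
      have hcoe : (⇑(b.toBasis.map T.toLinearEquiv) : Fin n → V₁) = F := by
        funext i; simp [hF]
      rw [hcoe, hc_def]
      exact h
    rw [hdet]
    exact prod_pos fun i _ ↦ hcpos i
  -- the pulled-back frame `f' = T⁻¹ c` is `2Kδ`-close to `b`
  set f' : Fin n → V₀ := fun i ↦ T.symm (c i) with hf'
  have hT2 : ‖(T.symm : V₁ →L[ℝ] V₀)‖ ≤ 2 := norm_symm_le_two_of_gram T b hδ0 hnδ hT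
  have hd : ∀ j, ‖f' j - b j‖ ≤ 2 * K * δ := by
    intro j
    have h1 : f' j - b j = T.symm (c j - F j) := by
      simp [hf', hF, map_sub]
    rw [h1]
    calc ‖T.symm (c j - F j)‖ ≤ ‖(T.symm : V₁ →L[ℝ] V₀)‖ * ‖c j - F j‖ := (T.symm : V₁ →L[ℝ] V₀).le_opNorm _
      _ ≤ 2 * (K * δ) := mul_le_mul hT2 (by rw [hc j]; exact hgs j) (norm_nonneg _) zero_le_two
      _ = 2 * K * δ := by ring
  have hd0 : 0 ≤ 2 * K * δ := by positivity
  have hd1 : 2 * K * δ ≤ 1 := by linarith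
  -- Warner's formula on `V₁` in the basis `c`, pulled back: a frame sum over `f'`
  have hinner1 : alternatingFormInner V₁ n k (α.compContinuousLinearMap (T.symm : V₁ →L[ℝ] V₀))
      (β.compContinuousLinearMap (T.symm : V₁ →L[ℝ] V₀)) =
        ((k ! : ℝ))⁻¹ * ∑ i : Fin k → Fin n, α (f' ∘ i) * β (f' ∘ i) := by
    rw [alternatingFormInner_eq_inv_factorial_mul_sum c]
    rfl
  -- the volume factor `v₁ = vol_{o₁}(T b)` and `v₀ = vol_{o₀}(f')`, `v₁ v₀ = 1`
  set v₁ : ℝ := (Orientation.map (Fin n) T.toLinearEquiv o₀).volumeForm (T ∘ b) with hv₁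
  set v₀ : ℝ := o₀.volumeForm f' with hv₀
  have hvv : v₁ * v₀ = 1 := volumeForm_map_mul_volumeForm_symm o₀ T b hb c hco
  have hv₀1 : |v₀ - 1| ≤ n * 2 ^ n * (2 * K * δ) := abs_volumeForm_sub_one_le o₀ b hb f' hd0 hd1 hd
  -- `|v₀ - 1| ≤ 1/2`, so `v₀ ≥ 1/2` and `|v₁| ≤ 2`, `|v₁ - 1| = |1 - v₀| |v₁| ≤ 2 |v₀ - 1|`
  have hsmall : n * 2 ^ n * (2 * K * δ) ≤ 1 / 2 := by linarith
  have hv₀ge : 1 / 2 ≤ v₀ := by have := (abs_le.1 hv₀1).1; linarith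
  have hv₀pos : 0 < v₀ := by linarith
  have hv₁eq : v₁ = v₀⁻¹ := eq_inv_of_mul_eq_one_left hvv
  have hv₁abs : |v₁| ≤ 2 := by
    rw [hv₁eq, abs_inv, abs_of_pos hv₀pos, inv_le_comm₀ hv₀pos two_pos]; linarith
  have hv₁1 : |v₁ - 1| ≤ 2 * (n * 2 ^ n * (2 * K * δ)) := by
    have : v₁ - 1 = v₁ * (1 - v₀) := by rw [mul_sub, mul_one, hvv]
    rw [this, abs_mul, abs_sub_comm]
    exact mul_le_mul hv₁abs hv₀1 (abs_nonneg _) zero_le_two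
  -- the main estimate with `v₀`, then switch to `v₁`
  set Pf : ℝ := alternatingFormInner V₀ n k α α + alternatingFormInner V₀ n k β β with hPf
  have hP0 : 0 ≤ Pf :=
    add_nonneg (alternatingFormInner_self_nonneg k α) (alternatingFormInner_self_nonneg k β)
  set Qf : ℝ := ((k ! : ℝ))⁻¹ * ∑ i : Fin k → Fin n, α (f' ∘ i) * β (f' ∘ i) with hQf
  have hmain : |Qf * v₀ - alternatingFormInner V₀ n k α β| ≤ C * (2 * K * δ) * Pf := by
    have h := abs_frameSum_mul_volumeForm_sub_alternatingFormInner_le o₀ b hb f' hd0 hd1 hd α β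
    rw [← hC] at h
    exact h
  -- `|Qf v₁ - Iab| ≤ |Qf v₀ - Iab| |v₁|² ... ` : write `Qf v₁ - Iab = (Qf v₀ - Iab) v₁² + Iab (v₁² - 1)` using `v₀ v₁ = 1`
  set Iab : ℝ := alternatingFormInner V₀ n k α β with hIab
  have hIabs : |Iab| ≤ Pf / 2 := abs_alternatingFormInner_le_add_div_two α β
  have hident : Qf * v₁ - Iab = (Qf * v₀ - Iab) * v₁ ^ 2 + Iab * (v₁ ^ 2 - 1) := by
    have : v₀ * v₁ = 1 := by rw [mul_comm]; exact hvv
    calc Qf * v₁ - Iab = Qf * (v₀ * v₁) * v₁ - Iab := by rw [this, mul_one]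
      _ = (Qf * v₀ - Iab) * v₁ ^ 2 + Iab * (v₁ ^ 2 - 1) := by ring
  have hv₁sq : v₁ ^ 2 ≤ 4 := by
    calc v₁ ^ 2 = |v₁| ^ 2 := (sq_abs v₁).symm
      _ ≤ 2 ^ 2 := pow_le_pow_left₀ (abs_nonneg v₁) hv₁abs 2
      _ = 4 := by norm_num
  have hv₁sq1 : |v₁ ^ 2 - 1| ≤ 3 * (2 * (n * 2 ^ n * (2 * K * δ))) := by
    have : v₁ ^ 2 - 1 = (v₁ - 1) * (v₁ + 1) := by ring
    rw [this, abs_mul]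
    have h3 : |v₁ + 1| ≤ 3 := (abs_add_le _ _).trans (by rw [abs_one]; linarith)
    calc |v₁ - 1| * |v₁ + 1| ≤ 2 * (n * 2 ^ n * (2 * K * δ)) * 3 :=
          mul_le_mul hv₁1 h3 (abs_nonneg _) (by positivity)
      _ = 3 * (2 * (n * 2 ^ n * (2 * K * δ))) := by ring
  rw [hinner1, hident]
  calc |(Qf * v₀ - Iab) * v₁ ^ 2 + Iab * (v₁ ^ 2 - 1)|
      ≤ |Qf * v₀ - Iab| * v₁ ^ 2 + |Iab| * |v₁ ^ 2 - 1| := by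
        refine (abs_add_le _ _).trans (add_le_add ?_ ?_)
        · rw [abs_mul, abs_of_nonneg (sq_nonneg v₁)]
        · rw [abs_mul]
    _ ≤ C * (2 * K * δ) * Pf * 4 + (Pf / 2) * (3 * (2 * (n * 2 ^ n * (2 * K * δ)))) :=
        add_le_add (mul_le_mul hmain hv₁sq (sq_nonneg _) (by positivity))
          (mul_le_mul hIabs hv₁sq1 (abs_nonneg _) (by positivity))
    _ = (8 * C * K + 6 * n * 2 ^ n * K) * δ * Pf := by ring
    _ ≤ L * δ * Pf := by
        refine mul_le_mul_of_nonneg_right (mul_le_mul_of_nonneg_right ?_ hδ0) hP0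
        have : 0 ≤ (n : ℝ) * 2 ^ n * K := by positivity
        rw [hL]; linarith
    _ ≤ ε * Pf := by
        refine mul_le_mul_of_nonneg_right ?_ hP0
        rw [le_div_iff₀ hL0] at hδc
        linarith

end Literature.Geometry.Kaehler
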